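/-
Copyright (c) 2026. All rights reserved.
Released under Apache 2.0 license as described in the file LICENSE.
Authors: HodgeCM publication cell (pub-hodgecm), GR lane, seat GR-2 (`pub-hodgecm-own-hyp34`).
-/
import Literature.NumberTheory.Weil1964.ArchFrameDictionaryGen
import HarnessLib

/-!
# The frame dictionary at ONE real place of `F` under ONE complex place of `E` (place type (i), no global choice)

Sequel of `ArchFrameDictionaryGen` §1/§3.  There (and in `ArchFollandDualPair.archUForm`, `ArchFollandUnitaryPlaces`)
the archimedean component `archUForm v u ∈ U(P_v, Q_v)` of `u ∈ U(J)(𝔸_F)` and the slice dictionary at a real place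
`v` of `F` are written for a GLOBAL choice `wOf : {v real} → {w complex}` of a `c`-fixed complex place of `E` over
EVERY real place of `F` (hypotheses `hw`, `hover` quantified over all `v`).  Such a choice exists only when no real
place of `F` splits in `E`.  For a general quadratic `E/F` (`E` with real places) this file repeats the two items with
the data of ONE place only — a real place `v` of `F`, a complex place `w` of `E` with `c • w = w` over `v`:

* §1 `archLocalForm_diagonal_at` (`σ_w(diag t₀ ⊗ 1) = diag(σ_v t₀)`), **`archUFormAt v w : U(J)(𝔸_F) →* U(P, Q)`**
  (`= archUForm … v` for a global choice, `archUForm_eq_archUFormAt`, `rfl`), `coe_archUFormAt`,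
  `continuous_archUFormAt`;
* §2 **`realSlice_archFolland_archAct_adelicToSymplectic_at`** / **`realSlice_archPhaseMap_adelicToSymplectic_at`**:
  in the twisted general Folland frame `scaledFrameGenT ψ (placeScale D) C` the real `v`-slices of
  `Ξ(archAct 𝕋 (ι_𝔸 u) (a, b))`, resp. of the archimedean phase map of `ι_𝔸 u`, are
  `reindexPhase ε ⇑(toSp (archUFormAt v w u))` of the `v`-slices — VERBATIM the proofs of `ArchFrameDictionaryGen`
  with the per-place core `ArchActQuadraticPlaces.placeVec_archAct_adelicToSymplectic`.

These are the type-(i) slice inputs of the dictionary `hdict` of `AdelicMetaplecticArchSection.archLift` for the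
archimedean Weil section over a general quadratic extension (real places of both types and complex places).
Topic `NumberTheory/Weil1964`; KERNEL ONLY: one definition with body and theorems; no `def … : Prop`, no named
fact, no `sorry`.  Written for the stage-1 cell `pub-hodgecm` (GR lane); nothing here is a claim of the manuscripts
adjudicated by that cell.

## References
* [GelbartRogawski1991] S. Gelbart, J. Rogawski, Invent. math. 105 (1991), §3.1 p. 454.
* [KonnoKonno2007] K. Konno, T. Konno, Kyushu J. Math. 61 (2007), §3.1 (3.1).
* [MoeglinVignerasWaldspurger1987] C. Mœglin, M.-F. Vignéras, J.-L. Waldspurger, LNM 1291 (1987), Chap. 1 I.17.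
* [Folland1989] G. B. Folland, *Harmonic Analysis in Phase Space*, Princeton UP 1989, Ch. 4 §1 Prop. (4.6), §1.3 (1.25).
-/

set_option autoImplicit false

open scoped Matrix Real Classical ComplexConjugate
open Complex NumberField NumberField.InfinitePlace NumberField.mixedEmbedding IsDedekindDomain
open Literature.NumberTheory.Automorphic Literature.NumberTheory.Automorphic.UnitaryGroup
open Literature.RepresentationTheory.HeisenbergGroup Literature.Analysis.SegalBargmann
open Literature.RepresentationTheory.KonnoKonno2007 Literature.RepresentationTheory.KonnoKonno2007.RealDualPair

noncomputable section

namespace Literature.NumberTheory.Weil1964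

local notation "PV" σ => (σ → ℝ) × (σ → ℝ)

/-! ## §1 The archimedean component at one real place under one complex place -/

section At

variable {F : Type} [Field F] [NumberField F] (E : Type) [Field E] [NumberField E] [Algebra F E] (c : E ≃ₐ[F] E)
  (N : ℕ) (hc : c ≠ 1) (v : {v : InfinitePlace F // v.IsReal}) (w : {w : InfinitePlace E // w.IsComplex})
  (hw : c • w.1 = w.1) (hover : w.1.comap (algebraMap F E) = v.1)
  (t₀ : Fin N → F) {J : Matrix (Fin N) (Fin N) E} (hJ : J = (Matrix.diagonal t₀).map (algebraMap F E))

include hc hw hover hJ in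
/-- `σ_w (diag(t₀) ⊗ 1) = diag(σ_v t₀) ⊗ 1 ∈ Mₙ(ℂ)` for ONE `c`-fixed complex place `w` of `E` over the real place `v`.
[cite: MoeglinVignerasWaldspurger1987, Chap. 1 I.17] -/
theorem archLocalForm_diagonal_at :
    J.map w.1.embedding = (Matrix.diagonal fun j => embedding_of_isReal v.2 (t₀ j)).map Complex.ofRealHom := by
  rw [UnitaryGroup.archLocalForm_eq_map F E c N w hw hc (Matrix.diagonal t₀) hJ, Matrix.diagonal_map (map_zero _)]
  exact congrArg (fun f : Fin N → ℝ => (Matrix.diagonal f).map Complex.ofRealHom)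
    (funext fun j => realPlaceMap_eq_embedding_of_isReal E c w hw hc v hover (t₀ j))

variable {P Q : Type*} [Fintype P] [DecidableEq P] [Fintype Q] [DecidableEq Q]
  (ε : Fin N ≃ P ⊕ Q) {D : Fin N → ℝ} (hD0 : ∀ j, D j ≠ 0) {c' : ℝ} (hc' : c' ≠ 0)
  (ht : ∀ j, embedding_of_isReal v.2 (t₀ j) = c' * signOf (ε j) * D j ^ 2)

/-- **`archUFormAt v w : U(J)(𝔸_F) →* U(P, Q)`** — the archimedean component at the `c`-fixed complex place `w` over
the real place `v` (`archAt w ∘ archPart`), conjugated by the adapted scaling `diag(D)` and sorted by the sign frame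
`ε : Fin N ≃ P ⊕ Q` (`σ_v(t₀ j) = c′ · signOf(ε j) · D_j²`); the datum of ONE place of `ArchFollandDualPair.archUForm`.
[cite: MoeglinVignerasWaldspurger1987, Chap. 1 I.17; GelbartRogawski1991, §3.1 p. 454] -/
def archUFormAt : UnitaryGroup.adelic F E c N J →* UForm P Q :=
  (toUForm ε hD0 hc' ((formCongr_scaleGL_smul_signForm ε hD0 c' ht).trans
      (archLocalForm_diagonal_at E c N hc v w hw hover t₀ hJ).symm)).comp
    ((archAt F E c N J w hw hc).comp (archPart F E c N J))

/-- for a global choice `wOf` of complex places over all real places, `archUForm … v = archUFormAt v (wOf v)`.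
[cite: MoeglinVignerasWaldspurger1987, Chap. 1 I.17] -/
theorem archUForm_eq_archUFormAt (wOf : {v : InfinitePlace F // v.IsReal} → {w : InfinitePlace E // w.IsComplex})
    (hwf : ∀ v, c • (wOf v).1 = (wOf v).1) (hoverf : ∀ v, (wOf v).1.comap (algebraMap F E) = v.1) :
    archUForm E c N hc wOf hwf hoverf t₀ hJ v ε hD0 hc' ht =
      archUFormAt E c N hc v (wOf v) (hwf v) (hoverf v) t₀ hJ ε hD0 hc' ht := rfl

/-- the matrix of `archUFormAt v w … u` is `reindex ε ε (scaleConj D (u_w))`, `u_w = archAt w (archPart u)`.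
[cite: MoeglinVignerasWaldspurger1987, Chap. 1 I.17] -/
theorem coe_archUFormAt (u : UnitaryGroup.adelic F E c N J) :
    (((archUFormAt E c N hc v w hw hover t₀ hJ ε hD0 hc' ht u : UForm P Q) : GL (P ⊕ Q) ℂ) : Matrix (P ⊕ Q) (P ⊕ Q) ℂ) =
      Matrix.reindex ε ε (scaleConj D
        (((archAt F E c N J w hw hc (archPart F E c N J u) : archLocal E N J w) : GL (Fin N) ℂ) :
          Matrix (Fin N) (Fin N) ℂ)) :=
  coe_toUForm ε hD0 hc' _ _

/-- `archUFormAt` is continuous. [cite: MoeglinVignerasWaldspurger1987, Chap. 1 I.17] -/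
theorem continuous_archUFormAt : Continuous (archUFormAt E c N hc v w hw hover t₀ hJ ε hD0 hc' ht) :=
  (continuous_toUForm ε hD0 hc' _).comp ((continuous_archAt F E c N J w hw hc).comp (continuous_archPart F E c N J))

end At

/-! ## §2 The slice dictionary at one real place under one complex place -/

section Real

variable {F : Type} [Field F] [NumberField F] (E : Type) [Field E] [NumberField E] [Algebra F E] (c : E ≃ₐ[F] E)
  (N : ℕ) (hc : c ≠ 1) (v : {v : InfinitePlace F // v.IsReal}) (w : {w : InfinitePlace E // w.IsComplex})
  (hw : c • w.1 = w.1) (hover : w.1.comap (algebraMap F E) = v.1)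
  (t₀ : Fin N → F) {J : Matrix (Fin N) (Fin N) E} (hJ : J = (Matrix.diagonal t₀).map (algebraMap F E))
  {P Q : Type*} [Fintype P] [DecidableEq P] [Fintype Q] [DecidableEq Q] (ε : Fin N ≃ P ⊕ Q)
  {D : {v : InfinitePlace F // v.IsReal} → Fin N → ℝ} (hD0 : ∀ v j, D v j ≠ 0) {c' : ℝ} (hc' : c' ≠ 0)
  (ht : ∀ j, embedding_of_isReal v.2 (t₀ j) = c' * signOf (ε j) * D v j ^ 2)
  (ψ : {v : InfinitePlace F // v.IsComplex} → (ℂ →+* ℂ)) (hψ : ∀ v, Continuous (ψ v))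
  (C : Fin N × {v : InfinitePlace F // v.IsComplex} → ℂ) (hC : ∀ k, C k ≠ 0)
  [Algebra.IsQuadraticExtension F E] {δ : E} (hcδ : c δ = -δ) (hδ : δ ≠ 0) {d : F}
  (hd : δ * δ = algebraMap F E d) (hT : (Matrix.diagonal t₀).IsSymm)

omit [NumberField F] [NumberField E] [Algebra F E] [Fintype P] [DecidableEq P] [Fintype Q] [DecidableEq Q]
  [Algebra.IsQuadraticExtension F E] in
include ht in
/-- the adapted condition `im σ_w(δ) · D_v² = ε · σ_v t₀` at the place `v`, from `σ_v t₀ = c′ ε D_v²`, `c′ = im σ_w(δ)`.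
[cite: Folland1989, Ch. 4 §1, Prop. (4.6) p. 151] -/
theorem adapted_of_ht_at (hcc' : c' = (w.1.embedding δ).im) (j : Fin N) :
    (w.1.embedding δ).im * D v j ^ 2 = signOf (ε j) * embedding_of_isReal v.2 (t₀ j) := by
  rw [ht j, ← hcc']
  have h := signOf_mul_self (ε j)
  linear_combination (-(c' * D v j ^ 2)) * h

/-- **The dictionary at one real place `v` under one complex place `w`.**  For `u ∈ U(J)(𝔸_F)`, `J = diag(t₀) ⊗ 1`,
the real `v`-slices of `Ξ(archAct 𝕋 (ι_𝔸 u) (a, b))` in the twisted general frame are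
`reindexPhase ε ⇑(toSp (archUFormAt v w u))` applied to the real `v`-slices of `Ξ(a, b)`.
[cite: GelbartRogawski1991, §3.1 p. 454; KonnoKonno2007, §3.1 (3.1); Folland1989, Ch. 4 §1, Prop. (4.6) p. 151] -/
theorem realSlice_archFolland_archAct_adelicToSymplectic_at (hcc' : c' = (w.1.embedding δ).im)
    (u : UnitaryGroup.adelic F E c N J) (a b : Fin N → mixedSpace F) :
    (realSlice (Fin N) v (archFolland ((Matrix.diagonal t₀).map (algebraMap F (AdeleRing (𝓞 F) F)))
        (scaledFrameGenT F (Fin N) ψ hψ (placeScale N D) (placeScale_ne_zero N hD0) C hC)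
        (archAct ((Matrix.diagonal t₀).map (algebraMap F (AdeleRing (𝓞 F) F)))
          (adelicToSymplectic F E c N hcδ hδ hd hT hJ u) (a, b))).1,
      realSlice (Fin N) v (archFolland ((Matrix.diagonal t₀).map (algebraMap F (AdeleRing (𝓞 F) F)))
        (scaledFrameGenT F (Fin N) ψ hψ (placeScale N D) (placeScale_ne_zero N hD0) C hC)
        (archAct ((Matrix.diagonal t₀).map (algebraMap F (AdeleRing (𝓞 F) F)))
          (adelicToSymplectic F E c N hcδ hδ hd hT hJ u) (a, b))).2) =
      reindexPhase ε
        (⇑((UForm.toSp P Q (archUFormAt E c N hc v w hw hover t₀ hJ ε (hD0 v) hc' ht u)).1 :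
          (PV (P ⊕ Q)) ≃ₗ[ℝ] PV (P ⊕ Q)))
        (realSlice (Fin N) v (archFolland ((Matrix.diagonal t₀).map (algebraMap F (AdeleRing (𝓞 F) F)))
            (scaledFrameGenT F (Fin N) ψ hψ (placeScale N D) (placeScale_ne_zero N hD0) C hC) (a, b)).1,
          realSlice (Fin N) v (archFolland ((Matrix.diagonal t₀).map (algebraMap F (AdeleRing (𝓞 F) F)))
            (scaledFrameGenT F (Fin N) ψ hψ (placeScale N D) (placeScale_ne_zero N hD0) C hC) (a, b)).2) := by
  set T𝔸 := (Matrix.diagonal t₀).map (algebraMap F (AdeleRing (𝓞 F) F)) with hT𝔸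
  set g := adelicToSymplectic F E c N hcδ hδ hd hT hJ u with hg
  rw [show archAct T𝔸 g (a, b) = ((archAct T𝔸 g (a, b)).1, (archAct T𝔸 g (a, b)).2) from rfl,
    realSlice_archFolland_twist_diagonal, realSlice_archFolland_twist_diagonal]
  have hslice := placeVec_archAct_adelicToSymplectic F E c N hcδ hδ hc hd hT hJ v w hw hover u a b
  rw [show (placeVec F (Fin N) v (archAct T𝔸 g (a, b)).1, placeVec F (Fin N) v (archAct T𝔸 g (a, b)).2) =
      (isQuadraticCoordinates_complex (w.1.embedding δ)
          (UnitaryGroup.re_embedding_delta F E c w hw hc hcδ)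
          (UnitaryGroup.im_embedding_delta_ne_zero F E c w hw hc hcδ hδ)).resEnd (Fin N)
        (((archAt F E c N J w hw hc (archPart F E c N J u) : archLocal E N J w) : GL (Fin N) ℂ) :
          Matrix (Fin N) (Fin N) ℂ)
        (placeVec F (Fin N) v a, placeVec F (Fin N) v b) from hslice]
  rw [follandScale_resEnd_eq_reindexPhase_twRealify (isQuadraticCoordinates_complex (w.1.embedding δ) _ _)
    (UnitaryGroup.re_embedding_delta F E c w hw hc hcδ) ε
    (t := fun j => embedding_of_isReal v.2 (t₀ j)) (D := fun j => placeScale N D (j, v))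
    (fun j => adapted_of_ht_at E N v w t₀ ε ht hcc' j) (fun j => hD0 v j)]
  congr 1
  rw [UForm.coe_toSp, coe_archUFormAt]

/-- **the real `v`-slices of the archimedean phase map of `ι_𝔸 u`** in the twisted general frame, at one real place
`v` under one complex place `w`. [cite: GelbartRogawski1991, §3.1 p. 454; KonnoKonno2007, §3.1 (3.1)] -/
theorem realSlice_archPhaseMap_adelicToSymplectic_at (hcc' : c' = (w.1.embedding δ).im)
    (hTu : IsUnit (archMat F (Fin N) ((Matrix.diagonal t₀).map (algebraMap F (AdeleRing (𝓞 F) F)))))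
    (u : UnitaryGroup.adelic F E c N J) (pq : PV (FrameIdx F (Fin N))) :
    (realSlice (Fin N) v (archPhaseMap ((Matrix.diagonal t₀).map (algebraMap F (AdeleRing (𝓞 F) F)))
        (scaledFrameGenT F (Fin N) ψ hψ (placeScale N D) (placeScale_ne_zero N hD0) C hC) hTu
        (adelicToSymplectic F E c N hcδ hδ hd hT hJ u) pq).1,
      realSlice (Fin N) v (archPhaseMap ((Matrix.diagonal t₀).map (algebraMap F (AdeleRing (𝓞 F) F)))
        (scaledFrameGenT F (Fin N) ψ hψ (placeScale N D) (placeScale_ne_zero N hD0) C hC) hTu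
        (adelicToSymplectic F E c N hcδ hδ hd hT hJ u) pq).2) =
      reindexPhase ε
        (⇑((UForm.toSp P Q (archUFormAt E c N hc v w hw hover t₀ hJ ε (hD0 v) hc' ht u)).1 :
          (PV (P ⊕ Q)) ≃ₗ[ℝ] PV (P ⊕ Q)))
        (realSlice (Fin N) v pq.1, realSlice (Fin N) v pq.2) := by
  obtain ⟨⟨a, b⟩, rfl⟩ := (archFolland_bijective (T := (Matrix.diagonal t₀).map (algebraMap F (AdeleRing (𝓞 F) F)))
    (scaledFrameGenT F (Fin N) ψ hψ (placeScale N D) (placeScale_ne_zero N hD0) C hC) hTu).2 pq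
  rw [archPhaseMap_archFolland]
  exact realSlice_archFolland_archAct_adelicToSymplectic_at E c N hc v w hw hover t₀ hJ ε hD0 hc' ht ψ hψ C hC hcδ hδ
    hd hT hcc' u a b

end Real

end Literature.NumberTheory.Weil1964

end
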